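import Literature.Probability.Percolation.CrossingChains
import HarnessLib

/-!
# Straight runs and scaled walks in `ℤ²`; their mesh geometry

Topic: Probability / Percolation (lattice-path combinatorics; companion to `PlanarDuality.lean`,
`LatticeTraceGeometry.lean`, `CrossingChains.lean`). Refining the mesh of a domain
discretisation from `δ` to `δ / M` turns a walk of the coarse lattice into a walk of the fine
lattice by subdividing each step into `M` unit steps. This file provides that construction and
its bookkeeping, used by the "bulk = largest mesh component" theorem for Jordan domains
(`LatticeModels/MeshDomainJordan.lean`, two-neck lemma):

* `runWalk d hd v n` — the straight walk `v, v + d, …, v + n d` for a unit step `d`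
  (`zdGraph_adj_add_right_iff`: `v ∼ v + d ↔ 0 ∼ d`); support and darts
  (`mem_support_runWalk_iff`, `exists_of_mem_darts_runWalk`);
* `scaleWalk M P` — the walk `P` scaled by `M : ℕ` (each step becomes a straight run of `M` unit
  steps); support, darts and edges (`mem_support_scaleWalk_iff`, `smul_mem_support_scaleWalk`,
  `exists_of_mem_darts_scaleWalk`);
* mesh geometry: at mesh `δ / M` the scaled vertex `M x` is the mesh-`δ` point `x`
  (`meshPoint_div_smul`), subdivision points lie on the coarse closed mesh edge
  (`meshPoint_subdivision_mem_segment`), vertices of the scaled walk lie on the coarse mesh trace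
  (`meshPoint_mem_meshTrace_of_mem_support_scaleWalk`) and fine closed mesh edges lie on coarse
  ones (`segment_subset_of_mem_edges_scaleWalk`);
* `exists_smul_eq_of_mem_support_scaleWalk` — a vertex of the scaled walk on a row divisible by
  `M` that is not flanked horizontally by vertices of the scaled walk is a scaled coarse vertex.

All statements are elementary lattice combinatorics (folklore). Mathlib anchors:
`SimpleGraph.Walk` (`append`, `copy`, `support`, `darts`, `edges`), `Function.iterate`,
`segment`, `Convex.segment_subset`. H21 anchors: `zdGraph`, `StepKind`/`stepKind_of_adj`
(`PlanarDuality.lean`), `meshPoint` (`DomainDiscretisation.lean`), `meshTrace`,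
`segment_meshPoint_subset_meshTrace` (`LatticeTraceGeometry.lean`),
`meshPoint_mem_meshTrace_of_mem_support` (`CrossingChains.lean`). Mathlib has no lattice-walk
scaling (searched `Walk.*scale`, `subdivide`).
-/

namespace Literature.Probability.Percolation

open Set Metric SimpleGraph

noncomputable section

/-! ### Straight runs and scaled walks in `ℤ²` -/

/-- Translation invariance of adjacency: `v ∼ v + d` iff `0 ∼ d` (i.e. `d = ± eᵢ`). [folklore] -/
theorem zdGraph_adj_add_right_iff (v d : LatticeModels.Site 2) : (LatticeModels.zdGraph 2).Adj v (v + d) ↔ (LatticeModels.zdGraph 2).Adj 0 d := by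
  have := LatticeModels.zdGraph_adj_shift_iff v 0 d
  simpa [LatticeModels.Site.shift_apply, add_comm] using this

/-- A lattice step `x ∼ y` has unit step vector: `0 ∼ y - x`. [folklore] -/
theorem zdGraph_adj_zero_sub {x y : LatticeModels.Site 2} (h : (LatticeModels.zdGraph 2).Adj x y) : (LatticeModels.zdGraph 2).Adj 0 (y - x) := by
  rw [← zdGraph_adj_add_right_iff x (y - x), add_sub_cancel]
  exact h

/-- The straight lattice walk `v, v + d, v + 2d, …` of `n` unit steps `d`. [folklore] -/
def runWalk (d : LatticeModels.Site 2) (hd : (LatticeModels.zdGraph 2).Adj 0 d) :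
    (v : LatticeModels.Site 2) → (n : ℕ) → (LatticeModels.zdGraph 2).Walk v ((fun w : LatticeModels.Site 2 => w + d)^[n] v)
  | _, 0 => Walk.nil
  | v, n + 1 => Walk.cons ((zdGraph_adj_add_right_iff v d).2 hd) (runWalk d hd (v + d) n)

/-- End-point of a straight run. [folklore] -/
theorem iterate_add_right_eq (d v : LatticeModels.Site 2) (n : ℕ) :
    (fun w : LatticeModels.Site 2 => w + d)^[n] v = v + (n : ℤ) • d := by
  induction n generalizing v with
  | zero => simp
  | succ n ih => rw [Function.iterate_succ_apply, ih]; simp only [Nat.cast_succ, add_smul, one_smul]; abel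

/-- Vertices of a straight run. [folklore] -/
theorem mem_support_runWalk_iff {d : LatticeModels.Site 2} {hd : (LatticeModels.zdGraph 2).Adj 0 d} {v w : LatticeModels.Site 2} {n : ℕ} :
    w ∈ (runWalk d hd v n).support ↔ ∃ j : ℕ, j ≤ n ∧ w = v + (j : ℤ) • d := by
  induction n generalizing v with
  | zero =>
    show w ∈ (Walk.nil : (LatticeModels.zdGraph 2).Walk v v).support ↔ _
    simp only [Walk.support_nil, List.mem_singleton]
    constructor
    · rintro rfl; exact ⟨0, le_rfl, by simp⟩
    · rintro ⟨j, hj, rfl⟩; obtain rfl : j = 0 := Nat.le_zero.1 hj; simp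
  | succ n ih =>
    show w ∈ (Walk.cons _ (runWalk d hd (v + d) n)).support ↔ _
    rw [Walk.support_cons, List.mem_cons, ih]
    constructor
    · rintro (rfl | ⟨j, hj, rfl⟩)
      · exact ⟨0, Nat.zero_le _, by simp⟩
      · exact ⟨j + 1, by omega, by simp only [Nat.cast_succ, add_smul, one_smul]; abel⟩
    · rintro ⟨j, hj, rfl⟩
      rcases j with - | j
      · left; simp
      · right; exact ⟨j, by omega, by simp only [Nat.cast_succ, add_smul, one_smul]; abel⟩

/-- Darts of a straight run: the steps `v + j d → v + (j + 1) d`, `j < n`. [folklore] -/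
theorem exists_of_mem_darts_runWalk {d : LatticeModels.Site 2} {hd : (LatticeModels.zdGraph 2).Adj 0 d} {v : LatticeModels.Site 2} {n : ℕ}
    {dt : (LatticeModels.zdGraph 2).Dart} (h : dt ∈ (runWalk d hd v n).darts) :
    ∃ j : ℕ, j < n ∧ dt.fst = v + (j : ℤ) • d ∧ dt.snd = v + ((j : ℤ) + 1) • d := by
  induction n generalizing v with
  | zero => exact absurd h (by show dt ∉ (Walk.nil : (LatticeModels.zdGraph 2).Walk v v).darts; simp)
  | succ n ih =>
    change dt ∈ (Walk.cons _ (runWalk d hd (v + d) n)).darts at h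
    rw [Walk.darts_cons, List.mem_cons] at h
    rcases h with rfl | h
    · exact ⟨0, Nat.succ_pos _, by simp, by simp⟩
    · obtain ⟨j, hj, h1, h2⟩ := ih h
      refine ⟨j + 1, by omega, ?_, ?_⟩
      · rw [h1]; simp only [Nat.cast_succ, add_smul, one_smul]; abel
      · rw [h2]; simp only [Nat.cast_succ, add_smul, one_smul]; abel

/-- The walk `P` scaled by the positive integer `M`: each step `x → y` becomes the straight run of
`M` unit steps from `M x` to `M y`. [folklore] -/
def scaleWalk (M : ℕ) : {a b : LatticeModels.Site 2} → (LatticeModels.zdGraph 2).Walk a b →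
    (LatticeModels.zdGraph 2).Walk ((M : ℤ) • a) ((M : ℤ) • b)
  | _, _, Walk.nil => Walk.nil
  | _, _, Walk.cons' a c _ h p =>
    ((runWalk (c - a) (zdGraph_adj_zero_sub h) ((M : ℤ) • a) M).copy rfl
      (by rw [iterate_add_right_eq, smul_sub, add_sub_cancel])).append (scaleWalk M p)

/-- Vertices of the scaled walk: the points `M x + j (y - x)`, `0 ≤ j ≤ M`, of its scaled steps
`x → y` (and the scaled start). [folklore] -/
theorem mem_support_scaleWalk_iff {M : ℕ} {a b : LatticeModels.Site 2} {P : (LatticeModels.zdGraph 2).Walk a b} {w : LatticeModels.Site 2} :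
    w ∈ (scaleWalk M P).support ↔ w = (M : ℤ) • a ∨
      ∃ dt ∈ P.darts, ∃ j : ℕ, j ≤ M ∧ w = (M : ℤ) • dt.fst + (j : ℤ) • (dt.snd - dt.fst) := by
  induction P with
  | nil => simp [scaleWalk]
  | cons h p ih =>
    rename_i a c b
    simp only [scaleWalk, Walk.mem_support_append_iff, Walk.support_copy, ih,
      Walk.darts_cons, List.mem_cons, mem_support_runWalk_iff]
    constructor
    · rintro (⟨j, hj, rfl⟩ | rfl | ⟨dt, hdt, j, hj, rfl⟩)
      · exact Or.inr ⟨_, Or.inl rfl, j, hj, rfl⟩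
      · exact Or.inr ⟨_, Or.inl rfl, M, le_rfl, by simp [smul_sub]⟩
      · exact Or.inr ⟨dt, Or.inr hdt, j, hj, rfl⟩
    · rintro (rfl | ⟨dt, rfl | hdt, j, hj, rfl⟩)
      · exact Or.inl ⟨0, Nat.zero_le _, by simp⟩
      · exact Or.inl ⟨j, hj, rfl⟩
      · exact Or.inr (Or.inr ⟨dt, hdt, j, hj, rfl⟩)

/-- The scaled vertices lie on the scaled walk. [folklore] -/
theorem smul_mem_support_scaleWalk {M : ℕ} {a b : LatticeModels.Site 2} {P : (LatticeModels.zdGraph 2).Walk a b} {x : LatticeModels.Site 2}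
    (hx : x ∈ P.support) : (M : ℤ) • x ∈ (scaleWalk M P).support := by
  induction P with
  | nil => simp only [Walk.support_nil, List.mem_singleton] at hx; subst hx; simp [scaleWalk]
  | cons h p ih =>
    rename_i a c b
    rw [Walk.support_cons, List.mem_cons] at hx
    simp only [scaleWalk, Walk.mem_support_append_iff, Walk.support_copy]
    rcases hx with rfl | hx
    · left; exact mem_support_runWalk_iff.2 ⟨0, Nat.zero_le _, by simp⟩
    · exact Or.inr (ih hx)

/-- Darts of the scaled walk: unit steps `M x + j (y - x) → M x + (j + 1)(y - x)`, `j < M`, of the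
scaled steps `x → y`. [folklore] -/
theorem exists_of_mem_darts_scaleWalk {M : ℕ} {a b : LatticeModels.Site 2} {P : (LatticeModels.zdGraph 2).Walk a b}
    {dt : (LatticeModels.zdGraph 2).Dart} (h : dt ∈ (scaleWalk M P).darts) :
    ∃ d ∈ P.darts, ∃ j : ℕ, j < M ∧ dt.fst = (M : ℤ) • d.fst + (j : ℤ) • (d.snd - d.fst) ∧
      dt.snd = (M : ℤ) • d.fst + ((j : ℤ) + 1) • (d.snd - d.fst) := by
  induction P with
  | nil => simp [scaleWalk] at h
  | cons h' p ih =>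
    rename_i a c b
    simp only [scaleWalk, Walk.darts_append, List.mem_append, Walk.darts_copy] at h
    rcases h with h | h
    · obtain ⟨j, hj, h1, h2⟩ := exists_of_mem_darts_runWalk h
      exact ⟨⟨(a, c), h'⟩, by simp, j, hj, h1, h2⟩
    · obtain ⟨d, hd, j, hj, h1, h2⟩ := ih h
      exact ⟨d, by simp [hd], j, hj, h1, h2⟩

/-! ### Mesh geometry of scaled walks -/

/-- `Site.toComplex` is `ℤ`-linear: scalar multiples. [folklore] -/
theorem toComplex_zsmul (n : ℤ) (x : LatticeModels.Site 2) : LatticeModels.Site.toComplex (n • x) = (n : ℂ) * LatticeModels.Site.toComplex x := by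
  apply Complex.ext <;> simp [LatticeModels.Site.toComplex]

/-- `Site.toComplex` is additive (subtraction). [folklore] -/
theorem toComplex_sub (x y : LatticeModels.Site 2) : LatticeModels.Site.toComplex (x - y) = LatticeModels.Site.toComplex x - LatticeModels.Site.toComplex y := by
  apply Complex.ext <;> simp [LatticeModels.Site.toComplex]

/-- Refining the mesh: the point `M x` at mesh `δ / M` is the point `x` at mesh `δ`. [folklore] -/
theorem meshPoint_div_smul {δ : ℝ} {M : ℕ} (hM : M ≠ 0) (x : LatticeModels.Site 2) :
    LatticeModels.meshPoint (δ / M) ((M : ℤ) • x) = LatticeModels.meshPoint δ x := by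
  simp only [LatticeModels.meshPoint, toComplex_zsmul]
  push_cast
  field_simp

/-- The subdivision points of a scaled step lie on the closed mesh edge of the step: at mesh
`δ / M`, the point `M x + j (y - x)` (`j ≤ M`) lies on `[δ x, δ y]`. [folklore] -/
theorem meshPoint_subdivision_mem_segment {δ : ℝ} {M : ℕ} (hM : M ≠ 0) (x y : LatticeModels.Site 2) {j : ℕ}
    (hj : j ≤ M) :
    LatticeModels.meshPoint (δ / M) ((M : ℤ) • x + (j : ℤ) • (y - x)) ∈ segment ℝ (LatticeModels.meshPoint δ x) (LatticeModels.meshPoint δ y) := by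
  rw [segment_eq_image']
  refine ⟨(j : ℝ) / M, ⟨by positivity, div_le_one_of_le₀ (by exact_mod_cast hj) (by positivity)⟩, ?_⟩
  simp only [LatticeModels.meshPoint, toComplex_add, toComplex_zsmul, toComplex_sub, Complex.real_smul]
  push_cast
  field_simp

/-- The edge of a dart of a walk is an edge of the walk. [folklore] -/
theorem edge_mem_edges_of_mem_darts {V : Type*} {G : SimpleGraph V} {a b : V} {p : G.Walk a b}
    {d : G.Dart} (h : d ∈ p.darts) : s(d.fst, d.snd) ∈ p.edges :=
  List.mem_map.2 ⟨d, h, rfl⟩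

/-- Mesh points of the vertices of the scaled walk lie on the mesh trace of the walk (for a walk
with at least one step). [folklore] -/
theorem meshPoint_mem_meshTrace_of_mem_support_scaleWalk {δ : ℝ} {M : ℕ} (hM : M ≠ 0)
    {a b : LatticeModels.Site 2} {P : (LatticeModels.zdGraph 2).Walk a b} (hP : ¬ P.Nil) {w : LatticeModels.Site 2}
    (hw : w ∈ (scaleWalk M P).support) : LatticeModels.meshPoint (δ / M) w ∈ meshTrace δ P := by
  rcases mem_support_scaleWalk_iff.1 hw with rfl | ⟨dt, hdt, j, hj, rfl⟩
  · rw [meshPoint_div_smul hM]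
    exact meshPoint_mem_meshTrace_of_mem_support hP P.start_mem_support
  · exact segment_meshPoint_subset_meshTrace (edge_mem_edges_of_mem_darts hdt)
      (meshPoint_subdivision_mem_segment hM _ _ hj)

/-- The closed mesh edges of the scaled walk (mesh `δ / M`) lie on the closed mesh edges of the
walk (mesh `δ`): the mesh trace only shrinks under refinement. [folklore] -/
theorem segment_subset_of_mem_edges_scaleWalk {δ : ℝ} {M : ℕ} (hM : M ≠ 0) {a b : LatticeModels.Site 2}
    {P : (LatticeModels.zdGraph 2).Walk a b} {p q : LatticeModels.Site 2} (h : s(p, q) ∈ (scaleWalk M P).edges) :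
    ∃ x y : LatticeModels.Site 2, s(x, y) ∈ P.edges ∧
      segment ℝ (LatticeModels.meshPoint (δ / M) p) (LatticeModels.meshPoint (δ / M) q) ⊆ segment ℝ (LatticeModels.meshPoint δ x) (LatticeModels.meshPoint δ y) := by
  rw [Walk.edges, List.mem_map] at h
  obtain ⟨dt, hdt, hdte⟩ := h
  obtain ⟨d, hd, j, hj, h1, h2⟩ := exists_of_mem_darts_scaleWalk hdt
  refine ⟨d.fst, d.snd, edge_mem_edges_of_mem_darts hd, ?_⟩
  have key : ∀ r : LatticeModels.Site 2, r = dt.fst ∨ r = dt.snd →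
      LatticeModels.meshPoint (δ / M) r ∈ segment ℝ (LatticeModels.meshPoint δ d.fst) (LatticeModels.meshPoint δ d.snd) := by
    rintro r (rfl | rfl)
    · rw [h1]; exact meshPoint_subdivision_mem_segment hM _ _ hj.le
    · rw [h2, show ((j : ℤ) + 1) = ((j + 1 : ℕ) : ℤ) by push_cast; ring]
      exact meshPoint_subdivision_mem_segment hM _ _ (by omega)
  have hpq : (p = dt.fst ∨ p = dt.snd) ∧ (q = dt.fst ∨ q = dt.snd) := by
    change s(dt.fst, dt.snd) = s(p, q) at hdte
    rw [Sym2.eq_iff] at hdte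
    rcases hdte with ⟨h, h'⟩ | ⟨h, h'⟩
    · exact ⟨Or.inl h.symm, Or.inr h'.symm⟩
    · exact ⟨Or.inr h'.symm, Or.inl h.symm⟩
  exact (convex_segment _ _).segment_subset (key p hpq.1) (key q hpq.2)


/-- **Scaled vertices are recognisable.** A vertex `v` of the scaled walk lying on a row whose
index is divisible by `M`, and not flanked on both horizontal sides by vertices of the scaled
walk, is `M x` for a vertex `x` of the original walk. (Interior subdivision points of a scaled
step are flanked by their two neighbours on the step, and those of vertical steps lie on rows
not divisible by `M`.) [folklore] -/
theorem exists_smul_eq_of_mem_support_scaleWalk {M : ℕ} (hM : M ≠ 0) {a b : LatticeModels.Site 2}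
    {P : (LatticeModels.zdGraph 2).Walk a b} {v : LatticeModels.Site 2} (hv : v ∈ (scaleWalk M P).support)
    (hdiv : (M : ℤ) ∣ v 1)
    (hnb : ¬ (v + Pi.single 0 1 ∈ (scaleWalk M P).support ∧
      v - Pi.single 0 1 ∈ (scaleWalk M P).support)) :
    ∃ x ∈ P.support, (M : ℤ) • x = v := by
  rcases mem_support_scaleWalk_iff.1 hv with rfl | ⟨d, hd, j, hjM, rfl⟩
  · exact ⟨a, P.start_mem_support, rfl⟩
  rcases Nat.eq_zero_or_pos j with rfl | hj0
  · exact ⟨d.fst, P.dart_fst_mem_support_of_mem_darts hd, by simp⟩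
  rcases hjM.eq_or_lt with rfl | hjM'
  · exact ⟨d.snd, P.dart_snd_mem_support_of_mem_darts hd, by simp [smul_sub]⟩
  exfalso
  -- an interior subdivision point, `0 < j < M`
  have hmem : ∀ i : ℕ, i ≤ M →
      (M : ℤ) • d.fst + (i : ℤ) • (d.snd - d.fst) ∈ (scaleWalk M P).support := fun i hi =>
    mem_support_scaleWalk_iff.2 (Or.inr ⟨d, hd, i, hi, rfl⟩)
  rcases stepKind_of_adj d.adj with ⟨h0, h1⟩ | ⟨h0, h1⟩ | ⟨h1, h0⟩ | ⟨h1, h0⟩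
  · -- right: `d.snd - d.fst = e₀`
    have hd' : d.snd - d.fst = Pi.single 0 1 := by
      ext i; fin_cases i <;> simp <;> omega
    apply hnb
    constructor
    · have := hmem (j + 1) (by omega)
      rw [hd'] at this ⊢
      convert this using 1
      simp only [Nat.cast_succ, add_smul, one_smul, add_assoc]
    · have := hmem (j - 1) (by omega)
      rw [hd'] at this ⊢
      convert this using 1
      rw [Nat.cast_sub (by omega), Nat.cast_one, sub_smul, one_smul, add_sub_assoc]
  · -- left: `d.snd - d.fst = -e₀`
    have hd' : d.snd - d.fst = -Pi.single 0 1 := by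
      ext i; fin_cases i <;> simp <;> omega
    apply hnb
    constructor
    · have := hmem (j - 1) (by omega)
      rw [hd'] at this ⊢
      convert this using 1
      rw [Nat.cast_sub (by omega), Nat.cast_one, sub_smul, one_smul]
      simp only [smul_neg, neg_sub_neg]
      abel
    · have := hmem (j + 1) (by omega)
      rw [hd'] at this ⊢
      convert this using 1
      simp only [Nat.cast_succ, add_smul, one_smul, smul_neg, neg_add]
      abel
  · -- up: the row is `M (d.fst 1) + j`, not divisible by `M`
    have hrow : ((M : ℤ) • d.fst + (j : ℤ) • (d.snd - d.fst)) 1 = M * d.fst 1 + j := by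
      simp [h1]
    rw [hrow] at hdiv
    have : (M : ℤ) ∣ (j : ℤ) := (dvd_add_right (dvd_mul_right _ _)).1 hdiv
    have := Nat.le_of_dvd hj0 (Int.natCast_dvd_natCast.1 this)
    omega
  · -- down
    have hrow : ((M : ℤ) • d.fst + (j : ℤ) • (d.snd - d.fst)) 1 = M * d.fst 1 - j := by
      simp [h1]; ring
    rw [hrow] at hdiv
    have : (M : ℤ) ∣ (j : ℤ) := by
      have h2 : (M : ℤ) ∣ (M : ℤ) * d.fst 1 - ((M : ℤ) * d.fst 1 - j) := dvd_sub (dvd_mul_right _ _) hdiv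
      simpa using h2
    have := Nat.le_of_dvd hj0 (Int.natCast_dvd_natCast.1 this)
    omega

end

end Literature.Probability.Percolation
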